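import Literature.MathematicalPhysics.QuantumManyBody.PeriodicMaxFormSimplicity
import Literature.MathematicalPhysics.QuantumManyBody.PeriodicMaxFormBoundHardCore
import Literature.MathematicalPhysics.QuantumManyBody.PeriodicHardCoreFormData
import Literature.MathematicalPhysics.QuantumManyBody.PeriodicHardCoreCutoffState
import Literature.Analysis.FunctionSpaces.TorusHardCoreCutoff
import Literature.Analysis.FunctionSpaces.TorusLineACLSpectral
import Summits.AtomisticToContinuum.BoseEinsteinCondensation.Theorems.BECConjugateDominationHardCoreExtensionTruncationReduction
import HarnessLib

/-!
# A Ky Fan gap of the truncations, uniform in the level, from simplicity of the maximal-form ground state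
# — stub `stub_uniformTruncationGap_of_simple` of line `third-law-current-floor`, crux
# `BECConjugateDomination.HardCoreExtension` (stmt-AtomisticToContinuum-11786)

**Statement (P4, (β') from simplicity).** Let `v` be a repulsive finite-range pair profile, `L > 0`,
`E₀(v) = periodicGroundStateEnergy v N L < ⊤`, and suppose that two non-zero elements of the maximal-form
ground-state class `maxFormGroundStates v N L` are never orthogonal. Then the truncations `vₙ = min(v, n)`
have a Ky Fan gap uniform in `n`: there are `γ > 0` and `n₀` with
`2 E₀(vₙ) + γ ≤ kyFanTwo vₙ N L` for all `n ≥ n₀`.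

**Proof (compactness).** Otherwise there are levels `n_k ≥ k` with `kyFanTwo v_{n_k} < 2E₀(v_{n_k}) + 1/(k+1)`,
hence (definition of `kyFanTwo` as an infimum) cell-orthogonal periodic trial states `A_k ⊥ B_k` with
`E_{n_k}[A_k], E_{n_k}[B_k] ≤ E₀(v) + 1/(k+1)` (each energy is `≥ E₀(v_{n_k})`, and `E₀(v_{n_k}) ≤ E₀(v)`).
Rellich compactness with memory of the subsequence (`exists_limitProfile_of_seq`, through the FREE form
domain), applied to `A` and then along the subsequence to `B`, gives `L²((ℝ/ℤ)^{3N})`-limits `η_A, η_B` of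
unit norm, Bose-symmetric in momentum space. For each fixed level `m` the truncation `v_m` is bounded of
finite range, so its pair interaction is integrable on the cell and the maximal form `Q_{v_m}` is lower
semicontinuous along the embedded states (`maxForm_le_of_tendsto`); since `Q_{v_m}(ιA_j) = E_{v_m}[A_j] ≤
E_{n_j}[A_j]` for `n_j ≥ m`, `Q_{v_m}(η_A) ≤ E₀(v)` for every `m`, and monotone convergence in `m` gives
`Q_v(η_A) ≤ E₀(v)`: `η_A` (and likewise `η_B`) is a maximal-form ground state. Finally
`⟪η_A, η_B⟫ = lim ⟪ιA_k, ιB_k⟫ = lim ∫ conj(A_k) B_k = 0` (`inner_formEmbed_graphEmbed`, continuity of the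
inner product): two orthogonal non-zero ground states, contradicting simplicity. The degenerate cases
(`kyFanTwo v_n = ⊤`, `N = 0`) cannot occur along the contradicting sequence.

Tree lemmas used: `exists_limitProfile_of_seq`, `maxForm_le_of_tendsto`, `periodicEnergy_eq_maxForm`,
`inner_formEmbed_graphEmbed`, `lintegral_cellN_periodicInteraction_ne_top_of_lintegral_ne_top`,
`monotone_periodicEnergy_truncPotential`, `periodicGroundStateEnergy_truncPotential_le'`,
`iSup_periodicInteraction_truncPotential`, `monotone_periodicInteraction_truncPotential`.

References: [ReedSimonIV1978] M. Reed, B. Simon, *Methods of Modern Mathematical Physics IV*, Thm. XIII.44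
and Thm. XIII.64; B. Simon, *Maximal and minimal Schrödinger forms*, J. Operator Theory 1 (1979) 37–47, Thm. 4.1.
-/

noncomputable section

namespace Summit.AtomisticToContinuum.BoseEinsteinCondensation.Cruxes.HardCoreExtension.ThirdLawCurrentFloorAlt

open MeasureTheory Filter UnitAddTorus
open scoped ENNReal NNReal BigOperators Topology InnerProductSpace ComplexConjugate
open Literature.MathematicalPhysics.QuantumManyBody.BoseGas
open Literature.Analysis.FunctionSpaces
open Summit.AtomisticToContinuum.BoseEinsteinCondensation.Cruxes.StaticResponseBound.UvThomsonForceWave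
open Summit.AtomisticToContinuum.BoseEinsteinCondensation.Cruxes.HardCoreExtension.ThirdLawCurrentFloor

attribute [local instance] Literature.MathematicalPhysics.QuantumManyBody.BoseGas.formDomain_measureSpace
  Literature.MathematicalPhysics.QuantumManyBody.BoseGas.formDomain_isProbabilityMeasure
  Literature.MathematicalPhysics.QuantumManyBody.BoseGas.formDomain_isProbabilityMeasure_pi

/-- Local notation for `L²((ℝ/ℤ)^{3N})` (Haar probability measure), as in the tree files. -/
local notation "L2T " N':max => Lp ℂ 2 (volume : Measure (UnitAddTorus (Fin N' × Fin 3)))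

variable {N : ℕ} {L : ℝ} {v : ℝ → ℝ≥0∞}

/-! ### Small `ℝ≥0∞` facts -/

/-- If `a + b < 2e + δ` with `e ≤ a` and `e ≤ b`, then `a < e + δ` and `b < e + δ`. [folklore] -/
theorem lt_add_and_lt_add_of_add_lt_two_mul_add {a b e δ : ℝ≥0∞} (ha : e ≤ a) (hb : e ≤ b)
    (h : a + b < 2 * e + δ) : a < e + δ ∧ b < e + δ := by
  have h2 : 2 * e + δ = e + δ + e := by ring
  constructor
  · by_contra h'
    push Not at h'
    exact lt_irrefl _ (((add_le_add h' hb).trans_lt h).trans_eq h2)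
  · by_contra h'
    push Not at h'
    have h3 : e + δ + e = e + (e + δ) := by ring
    exact lt_irrefl _ ((((add_le_add ha h').trans_lt h).trans_eq h2).trans_eq h3)

/-- `ofReal (1/(k+1)) ≤ 1`. [folklore] -/
theorem ofReal_one_div_add_one_le_one (k : ℕ) : ENNReal.ofReal (1 / ((k : ℝ) + 1)) ≤ 1 := by
  rw [← ENNReal.ofReal_one]
  exact ENNReal.ofReal_le_ofReal ((div_le_one (Nat.cast_add_one_pos k)).2
    (le_add_of_nonneg_left k.cast_nonneg))

/-- `ofReal (1/(φ i + 1)) → 0` along any strictly increasing `φ : ℕ → ℕ`. [folklore] -/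
theorem tendsto_ofReal_one_div_add_one {φ : ℕ → ℕ} (hφ : StrictMono φ) :
    Tendsto (fun i => ENNReal.ofReal (1 / ((φ i : ℝ) + 1))) atTop (𝓝 0) := by
  have h1 : Tendsto (fun i => (1 : ℝ) / ((φ i : ℝ) + 1)) atTop (𝓝 0) :=
    tendsto_one_div_add_atTop_nhds_zero_nat.comp hφ.tendsto_atTop
  have h2 := ENNReal.tendsto_ofReal h1
  rwa [ENNReal.ofReal_zero] at h2

/-! ### The truncations are integrable pair profiles -/

/-- A truncation `min(v, m)` of a finite-range profile is integrable on `ℝ³`: it is at most `m` on the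
ball of radius `R₀` and vanishes outside. [folklore] -/
theorem lintegral_truncPotential_norm_ne_top (hv : IsRepulsiveFiniteRange v) (m : ℕ) :
    (∫⁻ x : Space, truncPotential v m ‖x‖) ≠ ⊤ := by
  obtain ⟨R₀, hR₀⟩ := hv.2
  have hle : ∀ x : Space, truncPotential v m ‖x‖ ≤
      (Metric.closedBall (0 : Space) R₀).indicator (fun _ => (m : ℝ≥0∞)) x := by
    intro x
    by_cases hx : x ∈ Metric.closedBall (0 : Space) R₀
    · rw [Set.indicator_of_mem hx]
      exact truncPotential_le_nat v m _
    · rw [Set.indicator_of_notMem hx]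
      have hR : R₀ < ‖x‖ := by
        rwa [Metric.mem_closedBall, dist_zero_right, not_le] at hx
      exact (truncPotential_le v m _).trans (hR₀ _ hR).le
  refine ne_top_of_le_ne_top ?_ (lintegral_mono hle)
  rw [lintegral_indicator_const Metric.isClosed_closedBall.measurableSet]
  exact ENNReal.mul_ne_top (ENNReal.natCast_ne_top m) measure_closedBall_lt_top.ne

/-- The pair interaction of a truncation of a finite-range profile is integrable on the cell. [folklore] -/
theorem lintegral_cellN_periodicInteraction_truncPotential_ne_top (hL : 0 < L) (hv : IsRepulsiveFiniteRange v)
    (m N : ℕ) : ∫⁻ X in cellN N L, periodicInteraction (truncPotential v m) L X ≠ ⊤ :=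
  lintegral_cellN_periodicInteraction_ne_top_of_lintegral_ne_top hL (measurable_truncPotential hv.1 m)
    (lintegral_truncPotential_norm_ne_top hv m) N

/-! ### The maximal form: monotone convergence in the level and the free embedding of trial states -/

/-- **Monotone convergence of the maximal forms of the truncations**: `Q_v(η) = ⨆ₘ Q_{min(v,m)}(η)`
(Beppo Levi for the potential part; the kinetic part does not depend on the level). [folklore] -/
theorem maxForm_eq_iSup_truncPotential (hv : Measurable v) (L : ℝ) (η : L2T N) :
    maxForm v L η = ⨆ m : ℕ, maxForm (truncPotential v m) L η := by
  simp only [maxForm_def]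
  rw [← ENNReal.add_iSup]
  congr 1
  unfold maxFormPot
  rw [← lintegral_iSup' (fun m => aemeasurable_pot_integrand (measurable_truncPotential hv m) L η)
    (Eventually.of_forall fun t => fun m m' h => by
      dsimp only
      gcongr
      exact monotone_periodicInteraction_truncPotential v L _ h)]
  refine lintegral_congr fun t => ?_
  rw [← ENNReal.iSup_mul, iSup_periodicInteraction_truncPotential]

/-- **The maximal form of an embedded trial state is its energy** (free embedding, any measurable level
profile `w`): `Q_w(ι(graphEmbed Ψ)) = E_w[Ψ]`. [folklore] -/
theorem maxForm_formEmbed_free_trialState (hL : 0 < L) {w : ℝ → ℝ≥0∞} (hw : Measurable w)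
    (Ψ : PeriodicTrialState N L) :
    maxForm w L (formEmbed hL measurable_zeroProfile (lintegral_periodicInteraction_zero_ne_top N L)
        ⟨graphEmbed hL measurable_zeroProfile (lintegral_periodicInteraction_zero_ne_top N L)
          ⟨Ψ.ψ, Ψ.mem_periodicCore⟩, graphEmbed_mem_formDomain _ _ _ _⟩) = periodicEnergy w Ψ :=
  (periodicEnergy_eq_maxForm hL measurable_zeroProfile (lintegral_periodicInteraction_zero_ne_top N L) hw Ψ).symm

/-- **Limits of near-minimising truncation sequences have maximal form at most the target energy.**
If `Ψᵢ` are periodic trial states with `E_{min(v, levᵢ)}[Ψᵢ] ≤ E + εᵢ`, `levᵢ ≥ i`, `εᵢ → 0`, and the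
(freely) embedded classes `ι(graphEmbed Ψᵢ)` converge in `L²((ℝ/ℤ)^{3N})` to `η`, then `Q_v(η) ≤ E`
(lower semicontinuity of each truncated maximal form + monotone convergence in the level). [folklore] -/
theorem maxForm_le_of_tendsto_truncLevels (hv : IsRepulsiveFiniteRange v) (hL : 0 < L) {E : ℝ≥0∞}
    {Ψ : ℕ → PeriodicTrialState N L} {lev : ℕ → ℕ} (hlev : ∀ i, i ≤ lev i) {ε : ℕ → ℝ≥0∞}
    (hε : Tendsto ε atTop (𝓝 0)) (hEΨ : ∀ i, periodicEnergy (truncPotential v (lev i)) (Ψ i) ≤ E + ε i)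
    {η : L2T N}
    (hconv : Tendsto (fun i => formEmbed hL measurable_zeroProfile (lintegral_periodicInteraction_zero_ne_top N L)
        ⟨graphEmbed hL measurable_zeroProfile (lintegral_periodicInteraction_zero_ne_top N L)
          ⟨(Ψ i).ψ, (Ψ i).mem_periodicCore⟩, graphEmbed_mem_formDomain _ _ _ _⟩) atTop (𝓝 η)) :
    maxForm v L η ≤ E := by
  rw [maxForm_eq_iSup_truncPotential hv.1]
  refine iSup_le fun m => ?_
  have hconv' := hconv.comp (tendsto_add_atTop_nat m)
  refine maxForm_le_of_tendsto hL (measurable_truncPotential hv.1 m)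
    (lintegral_cellN_periodicInteraction_truncPotential_ne_top hL hv m N) hconv'
    (c := fun i => E + ε (i + m)) (fun i => ?_) ?_
  · exact (maxForm_formEmbed_free_trialState hL (measurable_truncPotential hv.1 m) (Ψ (i + m))).trans_le
      ((monotone_periodicEnergy_truncPotential v (Ψ (i + m)) ((Nat.le_add_left m i).trans (hlev _))).trans
        (hEΨ _))
  · have h := (tendsto_const_nhds (x := E)).add (hε.comp (tendsto_add_atTop_nat m))
    rwa [add_zero] at h

/-! ### The stub -/

/-- **P4 `stub_uniformTruncationGap_of_simple` ((β') from simplicity).** For a repulsive finite-range `v`,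
`L > 0`, `E₀(v) < ⊤`: if two non-zero maximal-form ground states of `v` are never orthogonal, then the
truncations `min(v, n)` have a Ky Fan gap UNIFORM in `n`: `2E₀(min(v,n)) + γ ≤ kyFanTwo (min(v,n))` for all
large `n`, for some `γ > 0` (compactness of near-optimal orthogonal pairs of the truncations through the free
form domain, lower semicontinuity and monotone convergence of the maximal form, continuity of the inner
product). [cite: ReedSimonIV1978, Thm. XIII.64] -/
theorem stub_uniformTruncationGap_of_simple :
    ∀ v : ℝ → ℝ≥0∞, IsRepulsiveFiniteRange v → ∀ (N : ℕ) (L : ℝ), 0 < L →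
      periodicGroundStateEnergy v N L ≠ ⊤ →
      (∀ η θ : Lp ℂ 2 (volume : Measure (UnitAddTorus (Fin N × Fin 3))),
        η ∈ maxFormGroundStates v N L → θ ∈ maxFormGroundStates v N L → η ≠ 0 → θ ≠ 0 → ⟪η, θ⟫_ℂ ≠ 0) →
      ∃ γ : ℝ, 0 < γ ∧ ∃ n₀ : ℕ, ∀ n : ℕ, n₀ ≤ n →
        2 * periodicGroundStateEnergy (fun r => min (v r) (n : ℝ≥0∞)) N L + ENNReal.ofReal γ ≤
          kyFanTwo (fun r => min (v r) (n : ℝ≥0∞)) N L := by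
  intro v hv N L hL hE hsimple
  change ∃ γ : ℝ, 0 < γ ∧ ∃ n₀ : ℕ, ∀ n : ℕ, n₀ ≤ n →
      2 * periodicGroundStateEnergy (truncPotential v n) N L + ENNReal.ofReal γ ≤
        kyFanTwo (truncPotential v n) N L
  by_contra hcon
  push Not at hcon
  -- Step 0: levels `n k ≥ k` along which the gap is `< 1/(k+1)`
  choose n hn hK using fun k : ℕ => hcon (1 / ((k : ℝ) + 1)) Nat.one_div_pos_of_nat k
  -- Step 1: near-optimal cell-orthogonal pairs
  have hpair : ∀ k, ∃ A B : PeriodicTrialState N L, (∫ X in cellN N L, conj (A.ψ X) * B.ψ X = 0) ∧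
      periodicEnergy (truncPotential v (n k)) A + periodicEnergy (truncPotential v (n k)) B <
        2 * periodicGroundStateEnergy (truncPotential v (n k)) N L + ENNReal.ofReal (1 / ((k : ℝ) + 1)) := by
    intro k
    have h := hK k
    unfold kyFanTwo at h
    obtain ⟨A, hA⟩ := iInf_lt_iff.1 h
    obtain ⟨B, hB⟩ := iInf_lt_iff.1 hA
    obtain ⟨hAB, hlt⟩ := iInf_lt_iff.1 hB
    exact ⟨A, B, hAB, hlt⟩
  choose A B horth hAB using hpair
  set E : ℝ≥0∞ := periodicGroundStateEnergy v N L with hEdef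
  have hAk : ∀ k, periodicEnergy (truncPotential v (n k)) (A k) ≤ E + ENNReal.ofReal (1 / ((k : ℝ) + 1)) :=
    fun k => (lt_add_and_lt_add_of_add_lt_two_mul_add
      (iInf_le (fun Ψ : PeriodicTrialState N L => periodicEnergy (truncPotential v (n k)) Ψ) (A k))
      (iInf_le (fun Ψ : PeriodicTrialState N L => periodicEnergy (truncPotential v (n k)) Ψ) (B k))
      (hAB k)).1.le.trans (add_le_add (periodicGroundStateEnergy_truncPotential_le' v (n k) N L) le_rfl)
  have hBk : ∀ k, periodicEnergy (truncPotential v (n k)) (B k) ≤ E + ENNReal.ofReal (1 / ((k : ℝ) + 1)) :=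
    fun k => (lt_add_and_lt_add_of_add_lt_two_mul_add
      (iInf_le (fun Ψ : PeriodicTrialState N L => periodicEnergy (truncPotential v (n k)) Ψ) (A k))
      (iInf_le (fun Ψ : PeriodicTrialState N L => periodicEnergy (truncPotential v (n k)) Ψ) (B k))
      (hAB k)).2.le.trans (add_le_add (periodicGroundStateEnergy_truncPotential_le' v (n k) N L) le_rfl)
  -- Step 2: compactness with memory, twice
  have hB1 : E + 1 ≠ ⊤ := ENNReal.add_ne_top.2 ⟨hE, ENNReal.one_ne_top⟩
  have hAbd : ∀ k, periodicEnergy (truncPotential v k) (A k) ≤ E + 1 := fun k =>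
    ((monotone_periodicEnergy_truncPotential v (A k) (hn k)).trans (hAk k)).trans
      (add_le_add le_rfl (ofReal_one_div_add_one_le_one k))
  obtain ⟨ηA, φ, hφ, hconvA, hnormA, hsymmA, -⟩ := exists_limitProfile_of_seq hv.1 hL hB1 A hAbd
  have hBbd : ∀ i, periodicEnergy (truncPotential v i) (B (φ i)) ≤ E + 1 := fun i =>
    ((monotone_periodicEnergy_truncPotential v (B (φ i)) (hφ.le_apply.trans (hn (φ i)))).trans
      (hBk (φ i))).trans (add_le_add le_rfl (ofReal_one_div_add_one_le_one _))
  obtain ⟨ηB, ψ, hψ, hconvB, hnormB, hsymmB, -⟩ :=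
    exists_limitProfile_of_seq hv.1 hL hB1 (fun i => B (φ i)) hBbd
  -- Step 3: the limits are maximal-form ground states
  have hηA : ηA ∈ maxFormGroundStates v N L := by
    refine ⟨hsymmA, ?_⟩
    rw [hnormA, one_pow, ENNReal.ofReal_one, mul_one]
    exact maxForm_le_of_tendsto_truncLevels hv hL (Ψ := fun i => A (φ i)) (lev := fun i => n (φ i))
      (fun i => hφ.le_apply.trans (hn (φ i))) (tendsto_ofReal_one_div_add_one hφ)
      (fun i => hAk (φ i)) hconvA
  have hηB : ηB ∈ maxFormGroundStates v N L := by
    refine ⟨hsymmB, ?_⟩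
    rw [hnormB, one_pow, ENNReal.ofReal_one, mul_one]
    exact maxForm_le_of_tendsto_truncLevels hv hL (Ψ := fun i => B (φ (ψ i))) (lev := fun i => n (φ (ψ i)))
      (fun i => (hψ.le_apply.trans hφ.le_apply).trans (hn _)) (tendsto_ofReal_one_div_add_one (hφ.comp hψ))
      (fun i => hBk (φ (ψ i))) hconvB
  have hA0 : ηA ≠ 0 := fun h => by
    rw [h, norm_zero] at hnormA
    exact zero_ne_one hnormA
  have hB0 : ηB ≠ 0 := fun h => by
    rw [h, norm_zero] at hnormB
    exact zero_ne_one hnormB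
  -- Step 4: orthogonality passes to the limit
  have hlim := Filter.Tendsto.inner (𝕜 := ℂ) (hconvA.comp hψ.tendsto_atTop) hconvB
  have hzero : ∀ i,
      ⟪formEmbed hL measurable_zeroProfile (lintegral_periodicInteraction_zero_ne_top N L)
          ⟨graphEmbed hL measurable_zeroProfile (lintegral_periodicInteraction_zero_ne_top N L)
            ⟨(A (φ (ψ i))).ψ, (A (φ (ψ i))).mem_periodicCore⟩, graphEmbed_mem_formDomain _ _ _ _⟩,
        formEmbed hL measurable_zeroProfile (lintegral_periodicInteraction_zero_ne_top N L)
          ⟨graphEmbed hL measurable_zeroProfile (lintegral_periodicInteraction_zero_ne_top N L)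
            ⟨(B (φ (ψ i))).ψ, (B (φ (ψ i))).mem_periodicCore⟩, graphEmbed_mem_formDomain _ _ _ _⟩⟫_ℂ = 0 := by
    intro i
    rw [inner_formEmbed_graphEmbed]
    exact horth _
  have hconst : Tendsto (fun i : ℕ =>
      ⟪formEmbed hL measurable_zeroProfile (lintegral_periodicInteraction_zero_ne_top N L)
          ⟨graphEmbed hL measurable_zeroProfile (lintegral_periodicInteraction_zero_ne_top N L)
            ⟨(A (φ (ψ i))).ψ, (A (φ (ψ i))).mem_periodicCore⟩, graphEmbed_mem_formDomain _ _ _ _⟩,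
        formEmbed hL measurable_zeroProfile (lintegral_periodicInteraction_zero_ne_top N L)
          ⟨graphEmbed hL measurable_zeroProfile (lintegral_periodicInteraction_zero_ne_top N L)
            ⟨(B (φ (ψ i))).ψ, (B (φ (ψ i))).mem_periodicCore⟩, graphEmbed_mem_formDomain _ _ _ _⟩⟫_ℂ)
      atTop (𝓝 0) := by
    simp only [hzero]
    exact tendsto_const_nhds
  exact hsimple ηA ηB hηA hηB hA0 hB0 (tendsto_nhds_unique hlim hconst)

end Summit.AtomisticToContinuum.BoseEinsteinCondensation.Cruxes.HardCoreExtension.ThirdLawCurrentFloorAlt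

end
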